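import Literature.NumberTheory.Sieve.LinearEquationsInPrimesRelativeInverse
import Literature.NumberTheory.Sieve.LinearEquationsInPrimesLevelTwoInputs
import Mathlib.NumberTheory.Bertrand
import HarnessLib

/-!
# Route `GreenTaoLevelTwo`, crux `GITwo` (stmt-Parity-21275), line `birth`: preliminaries for the
# transfer stub `stub_cyclicToInterval` (`[N] ↪ ℤ/N'ℤ`)

The registered glue stub `stub_cyclicToInterval : stub_cyclicInverse → GITwo` passes from the
`U³(ℤ/N'ℤ)` inverse theorem (Green–Tao 2008a, Thm. 12.8, `N'` prime) to the `U³[N]` inverse datum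
`GreenTao2010_inverseDatum 2 δ 𝓜 M c` (Green–Tao 2010, Prop. 8.4 / Lemma B.5).  This helper file
lands the two UNCONDITIONAL first steps of that passage, with explicit constants:

* `exists_prime_two_mul_lt_le_four_mul` — the auxiliary modulus: for `N ≥ 1` a prime `N'` with
  `2N < N' ≤ 4N` (Bertrand's postulate), so `N' > 2`, `N'` odd, and `[N]` does not wrap in `ℤ/N'ℤ`;
* `gowersPower_extendByZero_ge` — the lower half of Lemma B.5 at `k = 3` with the constant
  evaluated: if `δ ≤ ‖f‖_{U³[N]}` (`δ ≥ 0`) and `2N ≤ N' ≤ 4N` then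
  `(δ/5)⁸ ≤ ‖f 1_{[N]}‖_{U³(ℤ/N'ℤ)}⁸ = gowersPower 3 (extendByZero N' N f)`
  (tree: `uniformityNorm_pow_le_gowersPower_extendByZero`, constant `2·6³·4⁴ = 110592 ≤ 5⁸`),
  i.e. the cyclic inverse theorem is invoked with `η = δ/5`.

Also landed here (bookkeeping of the same passage): the re-indexing of the cyclic correlation
`𝔼_{n ∈ ℤ/N'ℤ} f̃(n + h) F(gⁿx₀)` over the representatives `[−(N'−1)/2, (N'−1)/2]` onto `m ∈ [N]`
(`sum_extendByZero_shift_mul_eq`), its splitting at `t = h₀ − (N'−1)/2` into two INTERVAL orbit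
sums (`sum_ite_threshold_eq`, `half_le_abs_or_of_le_abs_add`), the shifted base points
(`zpow_sub_smul_eq`) and the indicator form of an interval piece (`sum_Icc_eq_sum_indicator`).
What remains of the stub (repair census, not landed here): the circle-factor cutoff realising
`1_{[a,b]}(m)` up to `≤ 2N'/K + 2` terms (`0` terms once `K > N'`) by a `K`-Lipschitz function of
`m/N' ∈ ℝ/ℤ`, the product nilsequence `F ⊗ ψ` on `𝓜ᵢ × ℝ/ℤ` (class closed under `× circle`,
Lipschitz constant `max(M,0) + K` for the max metric), and the assembly with `η = δ/5`,
`c_G = c/2`, `K = 4⌈8/c⌉ + ⌈32/c⌉ + 1`.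

References: B. Green, T. Tao, *Linear equations in primes*, Ann. of Math. 171 (2010), App. B,
Lemma B.5 and Prop. 8.4 [GreenTao2010]; B. Green, T. Tao, *An inverse theorem for the Gowers U³(G)
norm*, Proc. Edinb. Math. Soc. 51 (2008), Thm. 12.8 [GreenTao2008U3Inverse].
-/

noncomputable section

open Literature.NumberTheory.Sieve

namespace Summit.Parity.GeneralizedHardyLittlewood.GreenTaoLevelTwoGITwoCyclicToInterval

/-- **The auxiliary prime modulus** (Bertrand): for `N ≥ 1` there is a prime `N'` with
`2N < N' ≤ 4N`; in particular `2 < N'`. [cite: GreenTao2010, App. B, proof of Lemma B.5 (choice of N')] -/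
theorem exists_prime_two_mul_lt_le_four_mul {N : ℕ} (hN : 1 ≤ N) :
    ∃ N' : ℕ, N'.Prime ∧ 2 * N < N' ∧ N' ≤ 4 * N ∧ 2 < N' := by
  obtain ⟨p, hp, hlt, hle⟩ := Nat.exists_prime_lt_and_le_two_mul (2 * N) (by omega)
  exact ⟨p, hp, hlt, by omega, by omega⟩

/-- **Lemma B.5, lower half, at `k = 3` with the constant evaluated**: for `1 ≤ N`,
`2N ≤ N' ≤ 4N`, `0 ≤ δ ≤ ‖f‖_{U³[N]}` one has `(δ/5)⁸ ≤ ‖f 1_{[N]}‖⁸_{U³(ℤ/N'ℤ)}`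
(`2 · 6³ · 4⁴ = 110592 ≤ 390625 = 5⁸`). [cite: GreenTao2010, App. B, Lemma B.5] -/
theorem gowersPower_extendByZero_ge {N N' : ℕ} [NeZero N'] (hN1 : 1 ≤ N) (hN : 2 * N ≤ N')
    (hN4 : N' ≤ 4 * N) {δ : ℝ} (hδ : 0 ≤ δ) (f : ℤ → ℝ)
    (hf : δ ≤ uniformityNorm 3 N (fun n => ((f n : ℝ) : ℂ))) :
    (δ / 5) ^ 8 ≤ gowersPower 3 (extendByZero N' N f) := by
  have hC' : (N' : ℝ) ≤ 4 * N := by exact_mod_cast hN4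
  have hB5 := uniformityNorm_pow_le_gowersPower_extendByZero (k := 3) (by norm_num) hN1 hN hC' f
  have h8 : δ ^ 8 ≤ uniformityNorm 3 N (fun n => ((f n : ℝ) : ℂ)) ^ (2 ^ 3) := by
    rw [show (2 : ℕ) ^ 3 = 8 by norm_num]
    exact pow_le_pow_left₀ hδ hf 8
  have hnum : (2 * (2 * (3 : ℕ)) ^ (3 : ℕ) * (4 : ℝ) ^ (3 + 1) : ℝ) = 110592 := by norm_num
  rw [hnum] at hB5
  have e : (δ / 5) ^ 8 = δ ^ 8 / 390625 := by ring
  rw [e, div_le_iff₀ (by norm_num : (0 : ℝ) < 390625)]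
  have hgp : 0 ≤ gowersPower 3 (extendByZero N' N f) := gowersPower_nonneg (by norm_num) _
  nlinarith

/-- **Re-indexing the cyclic correlation over `[N]`**: for `2N < N'`, `N'` odd, a shift `h ∈ ℤ/N'ℤ`
(lift `h₀ = h.val`) and any sequence `u` (in the application `u n = F(gⁿ x₀)`), the correlation of
`f 1_{[N]}` (extended by zero to `ℤ/N'ℤ` and shifted by `h`) against `u` over the representatives
`−(N'−1)/2 ≤ n ≤ (N'−1)/2` is the sum over `m ∈ [N]` of `f(m) u(n(m))`, where `n(m) = m − h₀` if
`m − h₀ ≥ −(N'−1)/2` and `n(m) = m − h₀ + N'` otherwise (each `m ∈ [N]` is hit by exactly one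
representative; `[N]` does not wrap since `N < N'/2`). [cite: GreenTao2010, App. B, proof of Lemma B.5 ("the interval [N] is Freiman isomorphic to its counterpart in ℤ_{N'}")] -/
theorem sum_extendByZero_shift_mul_eq {N N' : ℕ} [NeZero N'] (hNN' : 2 * N < N')
    (hodd : N' % 2 = 1) (f : ℤ → ℝ) (u : ℤ → ℝ) (hsh : ZMod N') :
    ∑ n ∈ Finset.Icc (-((N' : ℤ) / 2)) ((N' : ℤ) / 2),
        extendByZero N' N f ((n : ZMod N') + hsh) * u n =
      ∑ m ∈ Finset.Icc (1 : ℤ) N,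
        f m * u (if -((N' : ℤ) / 2) ≤ m - (hsh.val : ℤ) then m - (hsh.val : ℤ)
          else m - (hsh.val : ℤ) + N') := by
  set r : ℤ := (N' : ℤ) / 2 with hr
  set h₀ : ℤ := (hsh.val : ℤ) with hh₀
  have hodd' : (N' : ℤ) % 2 = 1 := by exact_mod_cast hodd
  have hN'r : (N' : ℤ) = 2 * r + 1 := by omega
  have hh0 : 0 ≤ h₀ := by positivity
  have hhN : h₀ < N' := by rw [hh₀]; exact_mod_cast ZMod.val_lt hsh
  have hNN'z : 2 * (N : ℤ) < N' := by exact_mod_cast hNN'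
  have hcast_h : ((h₀ : ℤ) : ZMod N') = hsh := by
    rw [hh₀, Int.cast_natCast, ZMod.natCast_zmod_val]
  -- the value of the shifted extension at the representative of `m`
  have hval : ∀ m : ℤ, 1 ≤ m → m ≤ N →
      extendByZero N' N f
          (((if -r ≤ m - h₀ then m - h₀ else m - h₀ + N' : ℤ) : ZMod N') + hsh) = f m := by
    intro m hm1 hmN
    have e : (((if -r ≤ m - h₀ then m - h₀ else m - h₀ + N' : ℤ) : ZMod N') + hsh) =
        ((m : ℤ) : ZMod N') := by
      split_ifs
      · rw [← hcast_h]; push_cast; ring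
      · rw [← hcast_h]; push_cast; rw [ZMod.natCast_self]; ring
    rw [e]
    exact extendByZero_intCast (by omega) f hm1 hmN
  symm
  refine Finset.sum_bij_ne_zero
    (fun m _ _ => if -r ≤ m - h₀ then m - h₀ else m - h₀ + N') ?_ ?_ ?_ ?_
  · -- lands in the representatives
    intro m hm _
    obtain ⟨hm1, hmN⟩ := Finset.mem_Icc.mp hm
    rw [Finset.mem_Icc]
    split_ifs with hc
    · constructor <;> omega
    · constructor <;> omega
  · -- injective
    intro m₁ hm₁ _ m₂ hm₂ _ heq
    obtain ⟨h11, h1N⟩ := Finset.mem_Icc.mp hm₁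
    obtain ⟨h21, h2N⟩ := Finset.mem_Icc.mp hm₂
    by_cases hc1 : -r ≤ m₁ - h₀ <;> by_cases hc2 : -r ≤ m₂ - h₀ <;>
      simp only [hc1, hc2, if_true, if_false] at heq <;> omega
  · -- surjective onto the non-zero terms
    intro n hn hne
    obtain ⟨hn1, hn2⟩ := Finset.mem_Icc.mp hn
    have hne' : extendByZero N' N f ((n : ZMod N') + hsh) ≠ 0 := by
      intro h0; exact hne (by rw [h0, zero_mul])
    obtain ⟨hv1, hvN⟩ := extendByZero_ne_zero hne'
    set m : ℤ := ((((n : ZMod N') + hsh).val : ℕ) : ℤ) with hm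
    have hm1 : 1 ≤ m := by rw [hm]; exact_mod_cast hv1
    have hmN : m ≤ N := by rw [hm]; exact_mod_cast hvN
    have hdvd : (N' : ℤ) ∣ (m - h₀ - n) := by
      apply (ZMod.intCast_zmod_eq_zero_iff_dvd _ _).mp
      push_cast
      rw [hm, hh₀, Int.cast_natCast, Int.cast_natCast, ZMod.natCast_zmod_val,
        ZMod.natCast_zmod_val]
      ring
    have him : (if -r ≤ m - h₀ then m - h₀ else m - h₀ + N') = n := by
      split_ifs with hc
      · have h0 : m - h₀ - n = 0 :=
          Int.eq_zero_of_abs_lt_dvd hdvd (by rw [abs_lt]; constructor <;> omega)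
        omega
      · have hdvd' : (N' : ℤ) ∣ (m - h₀ + N' - n) := by
          have e : m - h₀ + N' - n = (m - h₀ - n) + N' := by ring
          rw [e]; exact dvd_add hdvd dvd_rfl
        have h0 : m - h₀ + N' - n = 0 :=
          Int.eq_zero_of_abs_lt_dvd hdvd' (by rw [abs_lt]; constructor <;> omega)
        omega
    have hmem : m ∈ Finset.Icc (1 : ℤ) N := Finset.mem_Icc.mpr ⟨hm1, hmN⟩
    have hfm : f m * u (if -r ≤ m - h₀ then m - h₀ else m - h₀ + N') ≠ 0 := by
      rw [him, ← hval m hm1 hmN, him]; exact hne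
    exact ⟨m, hmem, hfm, him⟩
  · -- the terms agree
    intro m hm _
    obtain ⟨hm1, hmN⟩ := Finset.mem_Icc.mp hm
    rw [hval m hm1 hmN]

/-! ### The two interval pieces of the re-indexed correlation -/

/-- The re-indexed sum splits at the threshold `t = h₀ − (N'−1)/2` into the piece over
`[max(1, t), N]` (representatives `m − h₀`) and the piece over `[1, min(N, t − 1)]`
(representatives `m − h₀ + N'`): both index sets are sub-intervals of `[N]`.
[cite: GreenTao2010, App. B, proof of Lemma B.5] -/
theorem sum_ite_threshold_eq (N : ℕ) (r h₀ N'z : ℤ) (f u : ℤ → ℝ) :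
    ∑ m ∈ Finset.Icc (1 : ℤ) N,
        f m * u (if -r ≤ m - h₀ then m - h₀ else m - h₀ + N'z) =
      ∑ m ∈ Finset.Icc (max 1 (h₀ - r)) (N : ℤ), f m * u (m - h₀) +
        ∑ m ∈ Finset.Icc (1 : ℤ) (min (N : ℤ) (h₀ - r - 1)), f m * u (m - h₀ + N'z) := by
  classical
  rw [← Finset.sum_filter_add_sum_filter_not (Finset.Icc (1 : ℤ) N) (fun m => -r ≤ m - h₀)]
  have hA : (Finset.Icc (1 : ℤ) N).filter (fun m => -r ≤ m - h₀) =
      Finset.Icc (max 1 (h₀ - r)) (N : ℤ) := by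
    ext m
    simp only [Finset.mem_filter, Finset.mem_Icc, max_le_iff]
    omega
  have hB : (Finset.Icc (1 : ℤ) N).filter (fun m => ¬ -r ≤ m - h₀) =
      Finset.Icc (1 : ℤ) (min (N : ℤ) (h₀ - r - 1)) := by
    ext m
    simp only [Finset.mem_filter, Finset.mem_Icc, le_min_iff]
    omega
  rw [hA, hB]
  congr 1
  · refine Finset.sum_congr rfl fun m hm => ?_
    have h : -r ≤ m - h₀ := by
      have := (Finset.mem_Icc.mp hm).1; rw [max_le_iff] at this; omega
    rw [if_pos h]
  · refine Finset.sum_congr rfl fun m hm => ?_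
    have h : ¬ -r ≤ m - h₀ := by
      have := (Finset.mem_Icc.mp hm).2; rw [le_min_iff] at this; omega
    rw [if_neg h]

/-- Pigeonhole on the two pieces: if `C ≤ |A + B|` then `C/2 ≤ |A|` or `C/2 ≤ |B|`. [folklore] -/
theorem half_le_abs_or_of_le_abs_add {A B C : ℝ} (h : C ≤ |A + B|) :
    C / 2 ≤ |A| ∨ C / 2 ≤ |B| := by
  by_contra hcon
  push Not at hcon
  have := abs_add_le A B
  linarith [hcon.1, hcon.2]

/-- Reading an interval piece as an orbit sum from a SHIFTED base point with exponents in `ℕ`: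
`g^{m − h} x = g^{m} (g^{−h} x)` and `g^{m − h + N'} x = g^{m} (g^{N' − h} x)` for `m ≥ 0`
(`m` read in `ℕ` through `Int.toNat`). [folklore] -/
theorem zpow_sub_smul_eq {s : ℕ} (X : Nilmanifold s) (g : X.G) (x : X.G ⧸ X.Γ) (m h c : ℤ)
    (hm : 0 ≤ m) :
    g ^ (m - h + c) • x = g ^ m.toNat • (g ^ (c - h) • x) := by
  rw [← mul_smul, ← zpow_natCast, Int.toNat_of_nonneg hm, ← zpow_add]
  congr 2
  ring

/-- An interval piece `∑_{m ∈ [a, b]} f(m) u(m)` with `[a, b] ⊆ [1, N]` read over `[N]` against the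
indicator of `[a, b]` (the form in which a cutoff nilsequence replaces the indicator).
[cite: GreenTao2010, App. B, proof of Lemma B.5] -/
theorem sum_Icc_eq_sum_indicator {N : ℕ} {a b : ℤ} (ha : 1 ≤ a) (hb : b ≤ N) (f u : ℤ → ℝ) :
    ∑ m ∈ Finset.Icc a b, f m * u m =
      ∑ m ∈ Finset.Icc (1 : ℤ) N, f m * (u m * if a ≤ m ∧ m ≤ b then 1 else 0) := by
  classical
  rw [← Finset.sum_filter_add_sum_filter_not (Finset.Icc (1 : ℤ) N) (fun m => a ≤ m ∧ m ≤ b)]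
  have hI : (Finset.Icc (1 : ℤ) N).filter (fun m => a ≤ m ∧ m ≤ b) = Finset.Icc a b := by
    ext m
    simp only [Finset.mem_filter, Finset.mem_Icc]
    omega
  rw [hI]
  have h0 : ∑ m ∈ (Finset.Icc (1 : ℤ) N).filter (fun m => ¬ (a ≤ m ∧ m ≤ b)),
      f m * (u m * if a ≤ m ∧ m ≤ b then 1 else 0) = 0 := by
    refine Finset.sum_eq_zero fun m hm => ?_
    rw [if_neg (Finset.mem_filter.mp hm).2, mul_zero, mul_zero]
  rw [h0, add_zero]
  refine Finset.sum_congr rfl fun m hm => ?_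
  rw [if_pos (Finset.mem_Icc.mp hm), mul_one]

end Summit.Parity.GeneralizedHardyLittlewood.GreenTaoLevelTwoGITwoCyclicToInterval

end
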